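import Summits.QuantumFields.BalabanUV.T4Continuum.E3Cert.ZL3d2AllU.D_e0
import Summits.QuantumFields.BalabanUV.T4Continuum.E3Cert.ZL3d2AllU.D_e1
import Summits.QuantumFields.BalabanUV.T4Continuum.E3Cert.ZL3d2AllU.D_e2
import Summits.QuantumFields.BalabanUV.T4Continuum.E3Cert.ZL3d2AllU.D_e3
import Summits.QuantumFields.BalabanUV.T4Continuum.E3Cert.E3PolyCertZ
/-! E3 certificate package `ZL3d2AllU` — module `D_e` ((2,3,1) block, d = 2, L = 3, all-U; emitter `bal_e3_lean_emit.py` output for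
`block-L3d2-su2-allU-dyadic.json`, lane `run/shared/lean/ttrl/balaban-calc/e3/lean-draft/tree/zL3d2AllU/D_e.lean`; TREE COPY by the substrate cell (seat p2), typer
ruling (μ3)(e), journal l.19196, following the E3 PILOT's scripted road (`substrate/p3/E3-PILOT.md`): import prefix substituted and one-line
docstrings added BY SCRIPT, no literal touched).  Meaning of the certificate: see `Data.lean` ∕ `Main.lean` of this package and the checker
`E3Cert/E3PolyCertZ*.lean`.  HONEST: certified computation on ONE small block — NOT Prop. (1.8), NOT an input of any NE row today, NOT infinite
volume ∕ mass gap ∕ Clay. -/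
set_option maxRecDepth 200000
set_option maxHeartbeats 0
namespace E3Z
/-- E3 certificate `zL3d2AllU` component: `zL3d2AllU_eqs` (lane output, transcribed verbatim; see the module docstring). -/
def zL3d2AllU_eqs : List (Poly × Poly × Poly) := [zL3d2AllU_e0, zL3d2AllU_e1, zL3d2AllU_e2, zL3d2AllU_e3]
end E3Z
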